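import Mathlib.Tactic.Group
import Mathlib.GroupTheory.Abelianization.Defs
import Mathlib.GroupTheory.Subgroup.Centralizer
import Literature.Topology.FourManifolds.BalancedPresentationMoves
import HarnessLib

/-!
# Triangular balanced presentations are Andrews–Curtis trivial (the algebra of Kirby's proof of
# Addendum (C) to the cork theorem)

Topic `Literature/Topology/FourManifolds`.  Everything in this file is **proved**; it introduces
no definition and no named fact (D-0026).  "Killing a set `S` of generators" is written with
Mathlib's `FreeGroup.lift`: `erase_S = FreeGroup.lift fun j ↦ if j ∈ S then 1 else FreeGroup.of j`,
the endomorphism `xⱼ ↦ 1` (`j ∈ S`), `xⱼ ↦ xⱼ` (`j ∉ S`) of the free group.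

**The result.**  Call a balanced presentation `P = ⟨x₀, …, xₙ₋₁ ∣ r₀, …, rₙ₋₁⟩`
*triangular* (with respect to a rank function `rk : Fin n → ℕ`) if every relator `rᵢ` becomes
a conjugate of its own generator `xᵢ` once the generators of strictly smaller rank are set equal
to `1`:

  `IsConj (erase_{{j | rk j < rk i}} rᵢ) xᵢ` for all `i`.

Then `P` is Andrews–Curtis equivalent — by the three moves `rᵢ ↦ rᵢ⁻¹`, `rᵢ ↦ rᵢ rⱼ`,
`rᵢ ↦ x rᵢ x⁻¹` of `Literature.Topology.FourManifolds.IsAndrewsCurtisEquivalent`, *without*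
stabilisation — to the trivial presentation `⟨x₀, …, xₙ₋₁ ∣ x₀, …, xₙ₋₁⟩`
(`BalancedPresentation.isAndrewsCurtisEquivalent_trivial_of_isConj_erase`).  The proof
is the evident induction on the rank: once the relators of rank `< r` ARE their generators,
a relator `rᵢ` of rank `r` is multiplied by conjugates of those relators until all letters of
rank `< r` are gone (`IsAndrewsCurtisEquivalent.update_mul_of_mem_normalClosure`: multiplying a
relator by any element of the normal closure of the *other* relators is an Andrews–Curtis
equivalence; `BalancedPresentation.inv_mul_erase_mem_normalClosure`: `w⁻¹ · erase_S w` lies in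
the normal closure of the erased generators), after which it is a conjugate of `xᵢ` and is
conjugated to `xᵢ`.  Special cases recorded: one round (every relator is a conjugate of its
generator, `…_of_isConj`), and **two rounds** (`…_of_isConj_of_isConj_erase`: a set `E`
of relators are conjugates of their generators, and the others become conjugates of theirs after
the generators in `E` are killed), with the stable and `PresentsTrivialGroup` corollaries.

**Source and role (the cork theorem, H4).**  This is the group theory behind R. Kirby,
*Akbulut's corks and h-cobordisms of smooth, simply connected 4-manifolds* (Turkish J. Math. 20
(1996); arXiv:math/9712231), §4, proof of Addendum (C): *"Thus the 2-handles `H_l`,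
`l = 1, …, r`, kill `x₁, …, x_r` and then the 2-handles `H_{1,i}`, `i = 1, …, n`, kill the
generators `y₁, …, yₙ`.  Therefore `A₀ × I` is diffeomorphic to `B⁵`, because homotopy implies
isotopy for 1-manifolds in 4-manifolds, so the 2-handles geometrically cancel the 1-handles
since they do so homotopically"* — i.e. the handle presentation of the cork `A₀` read in
`π₁` of its 1-handlebody is triangular with two rounds (`E` = the `x`-generators; the relator
of `H_{1,i}` reads `∏ₐ x_a y_{j(a)}^{±1} x_a⁻¹` over the intersection points of `S_{1,i}` with
the `S_{0,j}`, grouped by `j` (*"we first run arcs from `*_{1,i}` to all points of intersection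
with `S_{0,1}`, then with `S_{0,2}`, …"*), with exponent sums `S_{0,j} · S_{1,i} = δᵢⱼ`, so that
killing the `x`'s leaves the cyclic word `y₁^{δ_{i1}} ⋯ yₙ^{δ_{in}} = yᵢ`), hence Andrews–Curtis
trivial, which is the hypothesis of the tree's named fact
`Literature.Topology.FourManifolds.IsPresentationHandlebodyFive.nonempty_diffeomorph_closedBall_of_isStablyAndrewsCurtisEquivalent`
(Andrews–Curtis 1965: `H⁵(P, ε) ≅ B⁵` for Andrews–Curtis trivial `P`) giving `A₀ × I ≅ B⁵` and
so `A₀ ∪_∂ A₀ = ∂(A₀ × I) ≅ S⁴` — the clause `IsDouble b₁ (𝓡 4) 𝕊⁴` of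
`Literature.Topology.FourManifolds.Matveyev1996_partOne_and_fact_of_dualSpheres` (H4) and of
`Literature.Topology.FourManifolds.Matveyev1996_partOne_and_fact`.

*How the two-round form arises on BOTH ends of the cork, in the boundary-free setting of (H4)*
(recorded here for the seat of (H4), since the printed proof is terse at exactly these points;
notation of Kirby §3: `V = h⁰ ∪ r` 1-handles `h_p` is the regular neighbourhood of the graph of
base arcs and arcs in the spheres, with one 1-handle for each intersection point `p` of some
`S_{0,j}` with some `S_{1,i}` and `x_p` the corresponding free generator of `π₁(V) = F(x)`;
`D_{0,j} = S_{0,j} ∩ V`, `D_{1,i} = S_{1,i} ∩ V` the discs with boundaries `K_{0,j}`, `K_{1,i}`,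
the attaching circles of the 2-handles `H_{0,j}`, `H_{1,i}`; the two disc systems are each
unknotted in `V` (take the 0-handle to contain the arcs of the other family), so that `V`
drilled along `D_{0,*}`, resp. `D_{1,*}`, is a 1-handlebody with
`π₁ = F(x, y) = π₁(∂V ∖ K_{0,*})`, resp. `F(x, z) = π₁(∂V ∖ K_{1,*})`, `y_j`, `z_i` the
meridians; near `p` the circles `K_{0,j(p)}`, `K_{1,i(p)}` clasp once, with the sign of `p`):
1. *Readings.*  In `F(x, y)` the circle `K_{1,i}` reads `σᵢ = ∏ₚ x_p y_{j(p)}^{±1} x_p⁻¹` over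
   the points `p` of `S_{1,i}` in the cyclic order of the arcs at `*_{1,i}`; choosing that order
   grouped by `j` (Kirby: *"we first run arcs from `*_{1,i}` to all points of intersection with
   `S_{0,1}`, then with `S_{0,2}`, …"*) and using the exponent sums `S_{0,j} · S_{1,i} = δᵢⱼ`
   gives `erase_x σᵢ ∼ yᵢ`.  Symmetrically `K_{0,j}` reads `κⱼ = ∏ₚ x_p z_{i(p)}^{±1} x_p⁻¹` in
   `F(x, z)` with `erase_x κⱼ ∼ zⱼ`.  The longitude of `K_{0,j}` is trivial in `F(x, y)` and
   reads `κⱼ` in `F(x, z)`; that of `K_{1,i}` is trivial in `F(x, z)` and reads `σᵢ` in `F(x, y)`.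
2. *The 2-handles of `B_{1/2}`.*  `X₁` (= `N` surgered along `S_{0,*}`: `V` drilled along
   `D_{0,*}`, the `H_{1,i}`, and the remaining handles `Hₘ, …` of `N`) and `X₂` are simply
   connected, so the classes of the attaching circles of all 2-handles of `N` normally generate
   both `F(x, y)` and `F(x, z)`.  A 2-handle born with a cancelling 3-handle and slid over
   2-handles of `N` along arcs acquires, in `Γ = π₁(∂V ∖ (K_{0,*} ∪ K_{1,*}))`, any prescribed
   element `g` of the normal closure `N_Γ` of the classes of the (push-offs of the) attaching
   circles; its images in `F(x, y)`, `F(x, z)` are the two readings of the new handle.  Choose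
   `g_p ∈ N_Γ` mapping to `x_p` in `F(x, y)` (possible: the image of `N_Γ` is everything); its
   image in `F(x, z)` is then `x_p k` with `k` in `Z = ⟨⟨z_*⟩⟩`, and `k` is corrected away inside
   `N_Γ ∩ ker(Γ → F(x, y))`, whose image in `F(x, z)` contains the conjugates of the `κⱼ` (images
   of the longitudes of the `K_{0,j}`) and `[F(x, z), Z]`, hence is all of `Z` BECAUSE the
   exponent-sum matrix of the `κⱼ` in the `z_i` is `(S_{1,i} · S_{0,j}) = 1` (so the `κⱼ` span
   `Z / [F, Z] ≅ ℤⁿ`) — the second use of algebraic duality.  So there are 2-handles `H'_p`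
   (`r` of them) reading EXACTLY `x_p` in `F(x, y)` and in `F(x, z)`.  This is Kirby's
   *"`H_l = x_l w_l`, `w_l` cancels away"*, done in `F(x, y)` and `F(x, z)` rather than in `F(x)`
   so that no `y`- or `z`-letters intrude — the point the printed proof leaves implicit (for `A₁`
   it says only *"Similarly `A₁ × I` is `B⁵`"*).  Put `B_{1/2} = V ∪ H'_*` (contractible:
   `π₁ = F(x)/⟨⟨x_*⟩⟩`, `H₂ = 0`) and `A_{1/2} = B_{1/2} ∪ H_{0,*} ∪ H_{1,*}`, `M = N ∖ int A_{1/2}`.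
3. *The two ends.*  `A₀ = A_{1/2}` surgered along `S_{0,*}` `= (V ∖ νD_{0,*}) ∪ H'_* ∪ H_{1,*}`
   has the presentation `⟨x, y ∣ x_p, σᵢ⟩`, and `A₁ = A_{1/2}` surgered along `S_{1,*}`
   `= (V ∖ νD_{1,*}) ∪ H'_* ∪ H_{0,*}` has `⟨x, z ∣ x_p, κⱼ⟩`: both two-round with `E = {x}`
   (`isAndrewsCurtisEquivalent_trivial_of_isConj_of_isConj_erase`), so
   `A₀ × I ≅ B⁵ ≅ A₁ × I` by the Andrews–Curtis fact; in particular both ends are contractible,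
   which for `A₁` is not otherwise available in (H4), where no ambient h-cobordism is given.
4. *(B).*  `A = A_{1/2} × I ∪` (3-handles on `S_{0,*} × {0}` and on `S_{1,*} × {1}`) has
   `∂A = A₀ ∪_∂ A₁`, and `A ≅ B_{1/2} × I ≅ B⁵`: the `2n` five-dimensional (2,3)-pairs
   `(H_{k,i} × I, h³_{k,i})` cancel (each attaching sphere meets the belt sphere of its own
   2-handle — the double of the cocore — once, transversely, and no other), and `B_{1/2} × I` is
   the one-round case (`x_p` exactly in `F(x)`; `isAndrewsCurtisEquivalent_trivial_of_isConj`).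
What this leaves for (H4) besides the present algebra: the 4-dimensional construction in `N`
(the plumbed neighbourhood `V₀ = V ∪ H_{0,*} ∪ H_{1,*}` with the readings of item 1, a handle
decomposition of `N` relative to `V₀`, births, slides with the `π₁`-bookkeeping of item 2, and
the identification of the two surgeries on `A_{1/2}` with the drilled handlebodies of item 3);
the product formula "`Δ⁴ × I` is an `H⁵(P_Δ, ε)`" and the (2,3)-cancellation lemma in
dimension 5 (Kosinski VI §7); the discharge of the Andrews–Curtis fact above (its geometric
layer G6, G8, G9 listed in `PresentationHandlebodyFiveProofs.lean`); and bookkeeping already in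
the tree (`∂(W × I) = D(W)`, `DoubleThickeningProofs.lean`; the gluing end
`X₁ = A₀ ∪ M`, `X₂ = A₁ ∪ M`, `SurgeryRegularDomain.lean`; contractibility from `W × I ≅ B⁵`,
`TwoHandlebodyContractible.lean`).  Matveyev's own route to the contractibility of both ends
(immersed geometric duals by Casson moves, *loc. cit.* pp. 1–2) and his Kirby-calculus proof of
Fact 1 are thereby avoided.

## References

* R. Kirby, *Akbulut's corks and h-cobordisms of smooth, simply connected 4-manifolds*, Turkish
  J. Math. 20 (1996) 85–93; arXiv:math/9712231: §3 and §4, proof of Addenda (B), (C)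
  (arXiv p. 3).  Held: `lit read arxiv:math/9712231`. [KirbyCorks1996]
* J. J. Andrews, M. L. Curtis, *Free groups and handlebodies*, Proc. Amer. Math. Soc. 16 (1965)
  192–195 (the moves; Theorem: Andrews–Curtis trivial ⇒ `H⁵(P, ε) ≅ B⁵`). [AndrewsCurtis1965]
* C. Hog-Angeloni, W. Metzler, *Geometric aspects of two-dimensional complexes*, Ch. I of
  *Two-dimensional homotopy and combinatorial group theory*, LMS LNS 197 (1993), §2.3
  (Q-transformations; multiplication by conjugates of other relators as a derived move).
  [HogAngeloniMetzler1993]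
* R. Matveyev, *A decomposition of smooth simply-connected h-cobordant 4-manifolds*,
  J. Differential Geom. 44 (1996) 571–582; arXiv:dg-ga/9505001, Fact 1 (p. 3). [Matveyev1996]
-/

noncomputable section

open Function

namespace Literature.Topology.FourManifolds

variable {n : ℕ}

/-! ### Multiplying a relator by a consequence of the other relators -/

namespace IsAndrewsCurtisEquivalent

open BalancedPresentation

/-- **Derived move: `rᵢ ↦ rᵢ · (w rⱼ w⁻¹)`** (`j ≠ i`, `w` any word) is an Andrews–Curtis
equivalence: conjugate `rⱼ` by `w`, multiply `rᵢ` by it, conjugate `rⱼ` back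
(Hog-Angeloni–Metzler 1993, Ch. I §2.3: the Q-transformations generate these).
[cite: HogAngeloniMetzler1993, Ch. I §2.3] -/
theorem update_mul_conj (P : BalancedPresentation n) {i j : Fin n} (hij : i ≠ j)
    (w : FreeGroup (Fin n)) :
    IsAndrewsCurtisEquivalent P (update P i (P i * (w * P j * w⁻¹))) := by
  have hji : j ≠ i := hij.symm
  -- two-entry bookkeeping with `a := j`, `b := i`
  have h₀ : P = update (update P j (P j)) i (P i) := (update₂_eq_self P).symm
  conv_lhs => rw [h₀]
  refine (update₂_conj_left P hji (P j) (P i) w).trans ?_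
  refine (update₂_mul_right P hji (w * P j * w⁻¹) (P i)).trans ?_
  refine (update₂_conj_left P hji (w * P j * w⁻¹) (P i * (w * P j * w⁻¹)) w⁻¹).trans ?_
  have e : w⁻¹ * (w * P j * w⁻¹) * w⁻¹⁻¹ = P j := by group
  rw [e, update₂_eq_update' ]
  · exact IsAndrewsCurtisEquivalent.refl _
  · exact hji
where
  /-- `update (update P a (P a)) b y = update P b y`. [folklore] -/
  update₂_eq_update' {P : BalancedPresentation n} {a b : Fin n} {y : FreeGroup (Fin n)}
      (_hab : a ≠ b) : update (update P a (P a)) b y = update P b y := by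
    rw [update_eq_self]

/-- **Multiplying a relator by any consequence of the other relators is an Andrews–Curtis
equivalence**: if `i ∉ S` and `g` lies in the normal closure of the relators `{rⱼ : j ∈ S}`,
then `rᵢ ↦ rᵢ g` is a finite sequence of Andrews–Curtis moves (induction on `g` as a product of
conjugates of the `rⱼ^{±1}`; the inverse of `rᵢ ↦ rᵢ g` is `rᵢ ↦ rᵢ g⁻¹`).
[cite: HogAngeloniMetzler1993, Ch. I §2.3] [cite: AndrewsCurtis1965] -/
theorem update_mul_of_mem_normalClosure (P : BalancedPresentation n) {i : Fin n}
    {S : Set (Fin n)} (hi : i ∉ S) {g : FreeGroup (Fin n)}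
    (hg : g ∈ Subgroup.normalClosure (P '' S)) :
    IsAndrewsCurtisEquivalent P (update P i (P i * g)) := by
  -- strengthen: for every `Q` agreeing with `P` on `S`
  suffices H : ∀ Q : BalancedPresentation n, (∀ j ∈ S, Q j = P j) →
      IsAndrewsCurtisEquivalent Q (update Q i (Q i * g)) from H P fun _ _ => rfl
  change g ∈ Subgroup.closure (Group.conjugatesOfSet (P '' S)) at hg
  induction hg using Subgroup.closure_induction with
  | mem x hx =>
    intro Q hQ
    obtain ⟨a, ⟨j, hjS, rfl⟩, hconj⟩ := Group.mem_conjugatesOfSet_iff.1 hx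
    obtain ⟨c, rfl⟩ := isConj_iff.1 hconj
    have hij : i ≠ j := fun h => hi (h ▸ hjS)
    rw [← hQ j hjS]
    exact update_mul_conj Q hij c
  | one =>
    intro Q _
    simpa using IsAndrewsCurtisEquivalent.refl Q
  | mul x y _ _ ihx ihy =>
    intro Q hQ
    have h₁ := ihx Q hQ
    set Q' : BalancedPresentation n := update Q i (Q i * x) with hQ'
    have hQ'S : ∀ j ∈ S, Q' j = P j := by
      intro j hj
      have hji : j ≠ i := fun h => hi (h ▸ hj)
      rw [hQ', update_of_ne hji, hQ j hj]
    have h₂ := ihy Q' hQ'S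
    have e : update Q' i (Q' i * y) = update Q i (Q i * (x * y)) := by
      rw [hQ', update_self, update_idem, mul_assoc]
    rw [e] at h₂
    exact h₁.trans h₂
  | inv x _ ih =>
    intro Q hQ
    set Q' : BalancedPresentation n := update Q i (Q i * x⁻¹) with hQ'
    have hQ'S : ∀ j ∈ S, Q' j = P j := by
      intro j hj
      have hji : j ≠ i := fun h => hi (h ▸ hj)
      rw [hQ', update_of_ne hji, hQ j hj]
    have h := ih Q' hQ'S
    have e : update Q' i (Q' i * x) = Q := by
      rw [hQ', update_self, update_idem, inv_mul_cancel_right, update_eq_self]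
    rw [e] at h
    exact h.symm

/-- **A relator conjugate to a word may be replaced by that word** (conjugation by the
conjugating element). [cite: AndrewsCurtis1965] -/
theorem update_of_isConj (P : BalancedPresentation n) (i : Fin n) {w : FreeGroup (Fin n)}
    (h : IsConj (P i) w) : IsAndrewsCurtisEquivalent P (update P i w) := by
  obtain ⟨c, hc⟩ := isConj_iff.1 h
  simpa [hc] using update_conj P i c

end IsAndrewsCurtisEquivalent

/-! ### Killing a set of generators -/

namespace BalancedPresentation

/-- **The kernel direction of a substitution `xⱼ ↦ 1` (`p j`), `xⱼ ↦ xⱼ` (`¬ p j`)**: for every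
word `w`, `w⁻¹ · erase w` lies in the normal closure of the killed generators `{xⱼ : p j}`
(induction on `w`; for a product, `(uv)⁻¹ e(uv) = v⁻¹ (u⁻¹ e u) v · v⁻¹ e v`). [folklore] -/
theorem inv_mul_erase_mem_normalClosure (p : Fin n → Prop) [DecidablePred p]
    (w : FreeGroup (Fin n)) :
    w⁻¹ * FreeGroup.lift (fun j => if p j then 1 else FreeGroup.of j) w ∈
      Subgroup.normalClosure (FreeGroup.of '' {j | p j}) := by
  set e : FreeGroup (Fin n) →* FreeGroup (Fin n) :=
    FreeGroup.lift (fun j => if p j then 1 else FreeGroup.of j) with he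
  set N := Subgroup.normalClosure (FreeGroup.of '' {j : Fin n | p j}) with hN
  have hNn : N.Normal := Subgroup.normalClosure_normal
  have e_of_pos : ∀ {x : Fin n}, p x → e (FreeGroup.of x) = 1 := fun {x} hx => by
    simp [he, hx]
  have e_of_neg : ∀ {x : Fin n}, ¬ p x → e (FreeGroup.of x) = FreeGroup.of x := fun {x} hx => by
    simp [he, hx]
  induction w with
  | C1 => simp [N.one_mem]
  | of x =>
    by_cases hx : p x
    · rw [e_of_pos hx, mul_one]
      exact N.inv_mem (Subgroup.subset_normalClosure ⟨x, hx, rfl⟩)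
    · rw [e_of_neg hx, inv_mul_cancel]
      exact N.one_mem
  | inv_of x _ =>
    rw [inv_inv, map_inv]
    by_cases hx : p x
    · rw [e_of_pos hx, inv_one, mul_one]
      exact Subgroup.subset_normalClosure ⟨x, hx, rfl⟩
    · rw [e_of_neg hx, mul_inv_cancel]
      exact N.one_mem
  | mul u v hu hv =>
    have eq : (u * v)⁻¹ * e (u * v) = v⁻¹ * (u⁻¹ * e u) * v⁻¹⁻¹ * (v⁻¹ * e v) := by
      rw [map_mul]; group
    rw [eq]
    exact N.mul_mem (hNn.conj_mem _ hu v⁻¹) hv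

/-- If the relators `rⱼ` with `p j` are their own generators, then replacing another relator
`rᵢ` (`¬ p i`) by its image under the substitution `xⱼ ↦ 1` (`p j`) is an Andrews–Curtis
equivalence (`rᵢ · (rᵢ⁻¹ erase rᵢ)`, the second factor a consequence of the relators
`xⱼ = rⱼ`, `p j`). [cite: KirbyCorks1996, §4, proof of Addendum (C)] [cite: AndrewsCurtis1965] -/
theorem isAndrewsCurtisEquivalent_update_erase (P : BalancedPresentation n)
    (p : Fin n → Prop) [DecidablePred p] {i : Fin n} (hi : ¬ p i)
    (hp : ∀ j, p j → P j = FreeGroup.of j) :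
    IsAndrewsCurtisEquivalent P
      (update P i (FreeGroup.lift (fun j => if p j then 1 else FreeGroup.of j) (P i))) := by
  have himg : P '' {j | p j} = FreeGroup.of '' {j | p j} :=
    Set.image_congr fun j hj => hp j hj
  have hg : (P i)⁻¹ * FreeGroup.lift (fun j => if p j then 1 else FreeGroup.of j) (P i) ∈
      Subgroup.normalClosure (P '' {j | p j}) := by
    rw [himg]
    exact inv_mul_erase_mem_normalClosure p (P i)
  have h := IsAndrewsCurtisEquivalent.update_mul_of_mem_normalClosure P (S := {j | p j}) hi hg
  rwa [mul_inv_cancel_left] at h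

/-! ### Triangular presentations are Andrews–Curtis trivial -/

/-- **Triangular balanced presentations are Andrews–Curtis trivial.**  If, for a rank function
`rk : Fin n → ℕ`, every relator `rᵢ` becomes a conjugate of its generator `xᵢ` under the
substitution `xⱼ ↦ 1` for `rk j < rk i`, then `P` is Andrews–Curtis equivalent (three moves, no
stabilisation) to the trivial presentation.  Induction on the rank `r`, maintaining a
presentation equivalent to `P` whose relators of rank `< r` are their generators and whose
other relators are untouched: a relator of rank `r` is first replaced by its image under the
substitution (`isAndrewsCurtisEquivalent_update_erase`) and then conjugated to its generator.
This is the algebra of Kirby's *"the `H_l` kill `x₁, …, x_r` and then the `H_{1,i}` kill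
`y₁, …, yₙ`"*. [cite: KirbyCorks1996, §4, proof of Addendum (C)] [cite: AndrewsCurtis1965] -/
theorem isAndrewsCurtisEquivalent_trivial_of_isConj_erase (P : BalancedPresentation n)
    (rk : Fin n → ℕ)
    (h : ∀ i, IsConj (FreeGroup.lift (fun j => if rk j < rk i then 1 else FreeGroup.of j) (P i))
      (FreeGroup.of i)) :
    IsAndrewsCurtisEquivalent P (BalancedPresentation.trivial n) := by
  classical
  -- Claim(r): the relators of rank `< r` can be made trivial, the others untouched
  have claim : ∀ r : ℕ, ∃ Q : BalancedPresentation n, IsAndrewsCurtisEquivalent P Q ∧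
      (∀ i, rk i < r → Q i = FreeGroup.of i) ∧ (∀ i, r ≤ rk i → Q i = P i) := by
    intro r
    induction r with
    | zero => exact ⟨P, IsAndrewsCurtisEquivalent.refl P,
        fun i hi => absurd hi (Nat.not_lt_zero _), fun _ _ => rfl⟩
    | succ r ih =>
      obtain ⟨Q₀, hPQ₀, hlt₀, hge₀⟩ := ih
      -- process the indices of rank exactly `r`, one at a time
      have inner : ∀ T : Finset (Fin n), (∀ i ∈ T, rk i = r) →
          ∃ Q : BalancedPresentation n, IsAndrewsCurtisEquivalent P Q ∧
            (∀ i, rk i < r ∨ i ∈ T → Q i = FreeGroup.of i) ∧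
            (∀ i, r ≤ rk i → i ∉ T → Q i = P i) := by
        intro T
        induction T using Finset.induction_on with
        | empty =>
          intro _
          exact ⟨Q₀, hPQ₀, fun i hi => hlt₀ i (hi.resolve_right (Finset.notMem_empty i)),
            fun i hi _ => hge₀ i hi⟩
        | insert a T haT ihT =>
          intro hT
          obtain ⟨Q, hPQ, hQlt, hQge⟩ := ihT fun i hi => hT i (Finset.mem_insert_of_mem hi)
          have hra : rk a = r := hT a (Finset.mem_insert_self a T)
          have haS : ¬ rk a < rk a := lt_irrefl _
          have hSQ : ∀ j, rk j < rk a → Q j = FreeGroup.of j :=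
            fun j hj => hQlt j (Or.inl (hra ▸ hj))
          have hQa : Q a = P a := hQge a (by omega) haT
          -- kill the lower-rank letters of `Q a = P a`, then conjugate to the generator
          have h₁ := isAndrewsCurtisEquivalent_update_erase Q (fun j => rk j < rk a) haS hSQ
          rw [hQa] at h₁
          set Q₁ : BalancedPresentation n := update Q a
            (FreeGroup.lift (fun j => if rk j < rk a then 1 else FreeGroup.of j) (P a)) with hQ₁
          have hconj : IsConj (Q₁ a) (FreeGroup.of a) := by
            rw [hQ₁, update_self]; exact h a
          have h₂ := IsAndrewsCurtisEquivalent.update_of_isConj Q₁ a hconj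
          have eQ : update Q₁ a (FreeGroup.of a) = update Q a (FreeGroup.of a) := by
            rw [hQ₁, update_idem]
          rw [eQ] at h₂
          refine ⟨update Q a (FreeGroup.of a), hPQ.trans (h₁.trans h₂), ?_, ?_⟩
          · intro i hi
            by_cases hia : i = a
            · subst hia; simp
            · rw [update_of_ne hia]
              rcases hi with hi | hi
              · exact hQlt i (Or.inl hi)
              · exact hQlt i (Or.inr ((Finset.mem_insert.1 hi).resolve_left hia))
          · intro i hi hiT
            have hia : i ≠ a := fun h' => hiT (h' ▸ Finset.mem_insert_self a T)
            rw [update_of_ne hia]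
            exact hQge i hi fun h' => hiT (Finset.mem_insert_of_mem h')
      obtain ⟨Q, hPQ, hQlt, hQge⟩ :=
        inner (Finset.univ.filter fun j => rk j = r) (fun i hi => by simpa using hi)
      refine ⟨Q, hPQ, fun i hi => ?_, fun i hi => ?_⟩
      · rcases Nat.lt_succ_iff_lt_or_eq.1 hi with hi | hi
        · exact hQlt i (Or.inl hi)
        · exact hQlt i (Or.inr (by simpa using hi))
      · exact hQge i (by omega) (by simp; omega)
  -- at `r = 1 + max rk` every relator is its generator
  obtain ⟨Q, hPQ, hQ, -⟩ := claim (Finset.univ.sup rk + 1)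
  have hQt : Q = BalancedPresentation.trivial n := by
    funext i
    exact hQ i (Nat.lt_succ_of_le (Finset.le_sup (f := rk) (Finset.mem_univ i)))
  exact hQt ▸ hPQ

/-- **One round**: a balanced presentation each of whose relators is a conjugate of its own
generator is Andrews–Curtis trivial (rank `0` everywhere: nothing to kill).  This is the case of
Kirby's `B_{1/2} × I ≅ B⁵` (*"the attaching maps of the `H_l`'s can be isotoped to geometrically
cancel the 1-handles"*, §4, proof of (B)) and of Mazur manifolds.
[cite: KirbyCorks1996, §4, proof of Addendum (B)] [cite: AndrewsCurtis1965] -/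
theorem isAndrewsCurtisEquivalent_trivial_of_isConj (P : BalancedPresentation n)
    (h : ∀ i, IsConj (P i) (FreeGroup.of i)) :
    IsAndrewsCurtisEquivalent P (BalancedPresentation.trivial n) := by
  refine isAndrewsCurtisEquivalent_trivial_of_isConj_erase P (fun _ => 0) fun i => ?_
  have e : (FreeGroup.lift fun j : Fin n => if (0 : ℕ) < 0 then (1 : FreeGroup (Fin n))
      else FreeGroup.of j) = MonoidHom.id _ := by
    refine FreeGroup.ext_hom _ _ fun a => ?_
    simp
  rw [e]
  exact h i

/-- **Two rounds (Kirby 1996, §4, proof of Addendum (C)).**  If the relators indexed by `E` are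
conjugates of their generators (*"the `H_l` kill `x₁, …, x_r`"*) and every other relator becomes
a conjugate of its generator under the substitution `xₑ ↦ 1` (`e ∈ E`) (*"and then the `H_{1,i}`
kill `y₁, …, yₙ`"*), then the presentation is Andrews–Curtis trivial (rank `0` on `E`, `1`
elsewhere). [cite: KirbyCorks1996, §4, proof of Addendum (C)] [cite: AndrewsCurtis1965] -/
theorem isAndrewsCurtisEquivalent_trivial_of_isConj_of_isConj_erase
    (P : BalancedPresentation n) (E : Finset (Fin n))
    (hE : ∀ e ∈ E, IsConj (P e) (FreeGroup.of e))
    (hrest : ∀ i ∉ E, IsConj (FreeGroup.lift (fun j => if j ∈ E then 1 else FreeGroup.of j) (P i))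
      (FreeGroup.of i)) :
    IsAndrewsCurtisEquivalent P (BalancedPresentation.trivial n) := by
  classical
  refine isAndrewsCurtisEquivalent_trivial_of_isConj_erase P
    (fun j => if j ∈ E then 0 else 1) fun i => ?_
  by_cases hi : i ∈ E
  · have e : (FreeGroup.lift fun j : Fin n =>
        if (if j ∈ E then 0 else 1) < (if i ∈ E then 0 else 1) then (1 : FreeGroup (Fin n))
        else FreeGroup.of j) = MonoidHom.id _ := by
      refine FreeGroup.ext_hom _ _ fun a => ?_
      simp [hi]
    rw [e]
    exact hE i hi
  · have e : (FreeGroup.lift fun j : Fin n =>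
        if (if j ∈ E then 0 else 1) < (if i ∈ E then 0 else 1) then (1 : FreeGroup (Fin n))
        else FreeGroup.of j) =
        FreeGroup.lift (fun j => if j ∈ E then 1 else FreeGroup.of j) := by
      refine FreeGroup.ext_hom _ _ fun a => ?_
      by_cases ha : a ∈ E <;> simp [hi, ha]
    rw [e]
    exact hrest i hi

/-- Two-round presentations are stably Andrews–Curtis trivial (no stabilisation needed), the
form of the hypothesis of
`Literature.Topology.FourManifolds.IsPresentationHandlebodyFive.nonempty_diffeomorph_closedBall_of_isStablyAndrewsCurtisEquivalent`.
[cite: KirbyCorks1996, §4, proof of Addendum (C)] [cite: AndrewsCurtis1965] -/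
theorem isStablyAndrewsCurtisEquivalent_trivial_of_isConj_of_isConj_erase
    (P : BalancedPresentation n) (E : Finset (Fin n))
    (hE : ∀ e ∈ E, IsConj (P e) (FreeGroup.of e))
    (hrest : ∀ i ∉ E, IsConj (FreeGroup.lift (fun j => if j ∈ E then 1 else FreeGroup.of j) (P i))
      (FreeGroup.of i)) :
    IsStablyAndrewsCurtisEquivalent P (BalancedPresentation.trivial n) :=
  ⟨0, isAndrewsCurtisEquivalent_trivial_of_isConj_of_isConj_erase P E hE hrest⟩

/-- Triangular presentations are stably Andrews–Curtis trivial.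
[cite: KirbyCorks1996, §4, proof of Addendum (C)] [cite: AndrewsCurtis1965] -/
theorem isStablyAndrewsCurtisEquivalent_trivial_of_isConj_erase
    (P : BalancedPresentation n) (rk : Fin n → ℕ)
    (h : ∀ i, IsConj (FreeGroup.lift (fun j => if rk j < rk i then 1 else FreeGroup.of j) (P i))
      (FreeGroup.of i)) :
    IsStablyAndrewsCurtisEquivalent P (BalancedPresentation.trivial n) :=
  ⟨0, isAndrewsCurtisEquivalent_trivial_of_isConj_erase P rk h⟩

/-- In particular a triangular presentation presents the trivial group (`π₁(A₀) = 1`,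
`π₁(A₁) = 1` for the two ends of Kirby's cork). [cite: KirbyCorks1996, §4] -/
theorem presentsTrivialGroup_of_isConj_erase (P : BalancedPresentation n) (rk : Fin n → ℕ)
    (h : ∀ i, IsConj (FreeGroup.lift (fun j => if rk j < rk i then 1 else FreeGroup.of j) (P i))
      (FreeGroup.of i)) :
    P.PresentsTrivialGroup :=
  (PresentsTrivialGroup.of_isAndrewsCurtisEquivalent
    (isAndrewsCurtisEquivalent_trivial_of_isConj_erase P rk h)).2
    (presentsTrivialGroup_trivial n)

end BalancedPresentation

/-! ### The exponent-sum correction (item 2 of the module docstring)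

In a free group `F = F(x ⊔ z)` let `Z = ⟨⟨z⟩⟩` be the normal closure of a set `T` of the
generators (the kernel of `x ↦ x, z ↦ 1`).  If a normal subgroup `H` makes `Z` central
(`[F, Z] ≤ H`) and contains, for every `t ∈ T`, an element `κ_t ∈ Z` with the exponent sums of
`z_t^{±1}` (same image in the abelianisation `F^{ab}`), then `Z ≤ H`: for `Z / [F, Z] ≅ ℤ^T` by
the exponent sums, and the `κ_t` span it.  In item 2 this is applied in `F(x, z)` to the image
`H` of `N_Γ ∩ ker(Γ → F(x, y))`, which contains `[F(x, z), Z]` and the words `κⱼ` of the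
`K_{0,j}`, whose exponent-sum matrix is `(S_{1,i} · S_{0,j}) = (±δᵢⱼ)` — algebraic duality;
the conclusion `Z ≤ H` is what allows the 2-handles `H'_p` of `B_{1/2}` to be corrected to read
`x_p` exactly in `F(x, z)` as well as in `F(x, y)`. -/

section ExponentSumCorrection

variable {ι : Type*}

/-- **Exponent-sum correction lemma.**  Let `T` be a set of free generators of `FreeGroup ι`,
`Z` the normal closure of `{xₜ : t ∈ T}`, and `H` a normal subgroup such that `g z g⁻¹ z⁻¹ ∈ H`
for all `g` and all `z ∈ Z` (i.e. `[F, Z] ≤ H`).  If for every `t ∈ T` some `κ ∈ H ∩ Z` has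
the image of `xₜ` or of `xₜ⁻¹` in the abelianisation (the exponent sums of `xₜ^{±1}`), then
`Z ≤ H`.  Proof: in `Q = F/H` the images of the `xₜ`, `t ∈ T`, are central, so
`xₜ ↦ π(xₜ)` (`t ∈ T`), `xᵢ ↦ 1` (`i ∉ T`) defines a homomorphism `L` of `F` into the
commutative subgroup they generate which agrees with `π` on the conjugates of the `xₜ`, hence
on `Z`; `L` factors through `F^{ab}`, so `1 = π(κ) = L(κ) = π(xₜ)^{±1}` and `xₜ ∈ H`.
(The group theory of Kirby 1996 §4 for the END `A₁` of the cork, see the module docstring,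
item 2; as a statement about free groups it is folklore: `Z/[F, Z]` is free abelian on `T`.)
[cite: KirbyCorks1996, §4, proof of Addendum (C) ("Similarly A₁ × I is B⁵")] -/
theorem freeGroup_normalClosure_le_of_abelianization_eq (T : Set ι) (H : Subgroup (FreeGroup ι))
    [H.Normal]
    (hcomm : ∀ g : FreeGroup ι, ∀ z ∈ Subgroup.normalClosure (FreeGroup.of '' T),
      g * z * g⁻¹ * z⁻¹ ∈ H)
    (hκ : ∀ t ∈ T, ∃ κ ∈ H, κ ∈ Subgroup.normalClosure (FreeGroup.of '' T) ∧
      (Abelianization.of κ = Abelianization.of (FreeGroup.of t) ∨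
        Abelianization.of κ = (Abelianization.of (FreeGroup.of t))⁻¹)) :
    Subgroup.normalClosure (FreeGroup.of '' T) ≤ H := by
  classical
  set Z := Subgroup.normalClosure (FreeGroup.of '' T) with hZ
  set π : FreeGroup ι →* FreeGroup ι ⧸ H := QuotientGroup.mk' H with hπ
  -- `π(Z)` is central in `Q = F/H`
  have hcentral : ∀ z ∈ Z, ∀ q : FreeGroup ι ⧸ H, q * π z = π z * q := by
    intro z hz q
    induction q using QuotientGroup.induction_on with
    | H g =>
      change π g * π z = π z * π g
      have h1 : π (g * z * g⁻¹ * z⁻¹) = 1 := by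
        rw [hπ, QuotientGroup.mk'_apply, QuotientGroup.eq_one_iff]
        exact hcomm g z hz
      have h2 : π g * π z * (π g)⁻¹ * (π z)⁻¹ = 1 := by simpa using h1
      calc π g * π z = π g * π z * (π g)⁻¹ * (π z)⁻¹ * (π z * π g) := by group
        _ = π z * π g := by rw [h2, one_mul]
  have hofZ : ∀ t ∈ T, FreeGroup.of t ∈ Z := fun t ht =>
    Subgroup.subset_normalClosure ⟨t, ht, rfl⟩
  -- the commutative subgroup generated by the `π(xₜ)`, `t ∈ T`
  set k : Set (FreeGroup ι ⧸ H) := π '' (FreeGroup.of '' T) with hk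
  have hkcomm : ∀ a ∈ k, ∀ b ∈ k, a * b = b * a := by
    rintro a ⟨u, ⟨t, ht, rfl⟩, rfl⟩ b _
    exact (hcentral _ (hofZ t ht) b).symm
  haveI : IsMulCommutative (Subgroup.closure k) := Subgroup.isMulCommutative_closure hkcomm
  open scoped IsMulCommutative in
  -- `L : xₜ ↦ π(xₜ)` (`t ∈ T`), `xᵢ ↦ 1` otherwise, into that commutative group
  set f : ι → Subgroup.closure k := fun i =>
    if hi : i ∈ T then ⟨π (FreeGroup.of i), Subgroup.subset_closure ⟨_, ⟨i, hi, rfl⟩, rfl⟩⟩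
    else 1 with hf
  set Lc : FreeGroup ι →* Subgroup.closure k := FreeGroup.lift f with hLc
  have hLc_of : ∀ t ∈ T, (Lc (FreeGroup.of t) : FreeGroup ι ⧸ H) = π (FreeGroup.of t) := by
    intro t ht
    simp [hLc, hf, ht]
  set L : FreeGroup ι →* FreeGroup ι ⧸ H := (Subgroup.closure k).subtype.comp Lc with hL
  -- `L = π` on the conjugates of the `xₜ`, hence on `Z`
  have hagree : Set.EqOn L π (Group.conjugatesOfSet (FreeGroup.of '' T)) := by
    intro w hw
    obtain ⟨a, ⟨t, ht, rfl⟩, hconj⟩ := Group.mem_conjugatesOfSet_iff.1 hw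
    obtain ⟨c, rfl⟩ := isConj_iff.1 hconj
    have e1 : L (c * FreeGroup.of t * c⁻¹) = L c * π (FreeGroup.of t) * (L c)⁻¹ := by
      rw [map_mul, map_mul, map_inv]
      congr 2
      rw [hL, MonoidHom.comp_apply, Subgroup.subtype_apply, hLc_of t ht]
    rw [e1, map_mul, map_mul, map_inv, hcentral _ (hofZ t ht) (L c), mul_inv_cancel_right,
      hcentral _ (hofZ t ht) (π c), mul_inv_cancel_right]
  have hZeq : Set.EqOn L π (Z : Set (FreeGroup ι)) := by
    have h := MonoidHom.eqOn_closure hagree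
    rwa [hZ, Subgroup.normalClosure] at *
  -- conclusion: every `xₜ`, `t ∈ T`, lies in `H`
  refine Subgroup.normalClosure_le_normal ?_
  rintro _ ⟨t, ht, rfl⟩
  obtain ⟨κ, hκH, hκZ, hab⟩ := hκ t ht
  have hπκ : π κ = 1 := by
    rw [hπ, QuotientGroup.mk'_apply, QuotientGroup.eq_one_iff]; exact hκH
  have hLκ : L κ = π κ := hZeq hκZ
  -- `Lc` factors through the abelianisation
  have hfac : ∀ w, Lc w = Abelianization.lift Lc (Abelianization.of w) := fun w => by
    rw [Abelianization.lift_apply_of]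
  have hLcκ : (Lc κ : FreeGroup ι ⧸ H) = π (FreeGroup.of t) ∨
      (Lc κ : FreeGroup ι ⧸ H) = (π (FreeGroup.of t))⁻¹ := by
    rcases hab with hab | hab
    · left
      rw [hfac, hab, ← hfac, hLc_of t ht]
    · right
      rw [hfac, hab, map_inv, ← hfac, Subgroup.coe_inv, hLc_of t ht]
  have hLκ' : L κ = (Lc κ : FreeGroup ι ⧸ H) := rfl
  have hπt : π (FreeGroup.of t) = 1 := by
    rcases hLcκ with h | h
    · rw [← h, ← hLκ', hLκ, hπκ]
    · have : (π (FreeGroup.of t))⁻¹ = 1 := by rw [← h, ← hLκ', hLκ, hπκ]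
      exact inv_eq_one.1 this
  rw [hπ, QuotientGroup.mk'_apply, QuotientGroup.eq_one_iff] at hπt
  exact hπt

end ExponentSumCorrection

end Literature.Topology.FourManifolds

end
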